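import Literature.NumberTheory.LFunctions.HeckeGaussianFourierComplex
import Literature.NumberTheory.LFunctions.HeckeThetaInversion
import HarnessLib

/-!
# Hecke's theta functions with a harmonic weight at a COMPLEX place, and their transformation formula

Topic `Literature/NumberTheory/LFunctions`; namespace `Literature.NumberTheory.LFunctions.NumberField`
(companion of `HeckeThetaInversion.lean`, which treats the sign weights `N(x^p)` at REAL places; this file treats
the admissible exponents supported at ONE COMPLEX place, Neukirch VII §3: `p_τ = m`, `p_τ̄ = 0`).  Analytic input of
Hecke's functional equation for the `L`-series of a Größencharakter of infinity type `(m, 0)` of an imaginary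
quadratic field (Hecke 1920; de Shalit 1987 II.1.1 (1)–(3); Neukirch VII (8.5)–(8.6)).

For a number field `K`, a complex place `w`, an exponent `m : ℕ`, a nonzero fractional ideal `𝔞`, a shift `a₀ ∈ K`
and `y ∈ R_+^*` we define (as complex numbers; `σ_w = w.embedding` is Mathlib's distinguished embedding of the place)

* `heckeThetaC K w m 𝔞 a₀ y = Σ_{a ∈ 𝔞} σ_w(a + a₀)^m e^{-π⟨(a+a₀)y, a+a₀⟩}`, the theta series of the coset `a₀ + 𝔞`
  with the harmonic weight `x_w^m` (Neukirch VII (3.4): `θ_Γ^p(a, b, z)` with `b = 0`, `z = iy`, `p` supported at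
  the complex place `w` with `p_w = m`);
* `heckeThetaDualC K w m 𝔟 a₀ y = Σ_{b ∈ 𝔟} e^{2πi Tr(a₀ b)} conj(σ_w(b))^m e^{-π⟨by, b⟩}`, the dual
  (character-twisted, unshifted) series (Neukirch's `θ_{Γ'}^p(-b, a, ·)` side of (3.6) for the twisted dual
  lattice `*Γ'`: the involution `*` conjugates the complex coordinates, whence the weight `x̄_w^m`),

and PROVE the **theta transformation formula** (Neukirch VII (3.6) for `Γ = j(𝔞)`, `Γ' = *j((𝔞𝔡)⁻¹)` (VII (5.7)),
`z = iy`):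

  `heckeThetaC K w m 𝔞 a₀ y = (-i)^m · (y_w^m N(y)^{1/2} 𝔑(𝔞) √|d_K|)⁻¹ · heckeThetaDualC K w m (𝔞𝔡)⁻¹ a₀ y⁻¹`
  (`heckeThetaC_eq_heckeThetaDualC`; Neukirch's factor `N((z/i)^{p + 1/2})⁻¹` at `z = i y⁻¹`… here read at `y`).

## Proof

Exactly as `heckeTheta_eq_heckeThetaDual` (`HeckeThetaInversion.lean`): Poisson summation
(`Fourier.tsum_eq_tsum_fourier_of_rpow_decay`) in the euclidean Minkowski space `V` for the scaled ideal lattice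
`Λ_y = toMixed⁻¹(c · j(𝔞))`, `c_v = (e_v y_v)^{1/2}`, whose dual lattice is `toMixed⁻¹(c⁻¹ · *j((𝔞𝔡)⁻¹))`
(`dualIdealEquivDualLattice`), applied to the translate `v ↦ (ℓ^m G)(v + x₀)`, `x₀ = toMixed⁻¹(c · j(a₀))`, of the
harmonic multiple `ℓ(v)^m e^{-π‖v‖²}` of the Gaussian, `ℓ(v) = ⟨v, E_{w,1}⟩ + i⟨v, E_{w,i}⟩` the complex coordinate at
`w` (`E_{w,1}, E_{w,i}` the two unit vectors of the place `w` in Mathlib's orthonormal basis), whose Fourier transform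
is `e^{2πi⟨x₀,ξ⟩} (-i)^m ℓ(ξ)^m G(ξ)` (`Fourier.fourier_cpowGaussian_add`, `HeckeGaussianFourierComplex.lean`).  On
lattice vectors `ℓ(toMixed⁻¹(c·j(a))) = c_w σ_w(a) = (2y_w)^{1/2} σ_w(a)`, on dual vectors
`ℓ(toMixed⁻¹(c⁻¹·*j(a'))) = 2 c_w⁻¹ conj(σ_w(a'))`, and `⟨x₀, toMixed⁻¹(c⁻¹·*j(a'))⟩ = Tr(a₀ a')`
(`inner_dualVector_latticeVector`); the two powers of `c_w` combine to `(2/c_w²)^m = y_w^{-m}`.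

## References

* J. Neukirch, *Algebraic Number Theory*, Grundlehren 322, Springer 1999, Ch. VII §3 (3.3) Proposition, (3.4)
  Definition, (3.6) Theta Transformation Formula (admissible `p` at complex places); §5 (5.7). [NeukirchANT1999]
* E. Hecke, *Eine neue Art von Zetafunktionen und ihre Beziehungen zur Verteilung der Primzahlen II*, Math. Z. 6
  (1920), 11–51. [HeckeMathZ1920]
-/

noncomputable section

open MeasureTheory Filter Set Submodule Complex NumberField NumberField.InfinitePlace
  NumberField.mixedEmbedding
open scoped Real Topology FourierTransform ENNReal NumberField nonZeroDivisors ComplexConjugate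
  RealInnerProductSpace

namespace Literature.NumberTheory.LFunctions

namespace NumberField

variable (K : Type*) [Field K] [NumberField K]

open scoped Classical

/-! ## The two unit vectors of a complex place and the complex coordinate `ℓ_w` -/

/-- The unit vector `E_{w,1} ∈ V` of the complex place `w` (the basis vector `1 ∈ ℂ` of the `w`-coordinate in Mathlib's
orthonormal basis `stdOrthonormalBasis` of the euclidean Minkowski space). [folklore] -/
def complexPlaceVectorRe (w : {w : InfinitePlace K // IsComplex w}) : euclidean.mixedSpace K :=
  euclidean.stdOrthonormalBasis K (Sum.inr (w, 0))

/-- The unit vector `E_{w,i} ∈ V` of the complex place `w` (the basis vector `i ∈ ℂ` of the `w`-coordinate).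
[folklore] -/
def complexPlaceVectorIm (w : {w : InfinitePlace K // IsComplex w}) : euclidean.mixedSpace K :=
  euclidean.stdOrthonormalBasis K (Sum.inr (w, 1))

variable {K}

/-- `⟪toMixed⁻¹ u, E_{w,1}⟫ = Re u_w`. [cite: NeukirchANT1999, Ch. VII §3 (3.4) (proof steps)] -/
theorem inner_toMixed_symm_complexPlaceVectorRe (u : mixedSpace K) (w : {w : InfinitePlace K // IsComplex w}) :
    ⟪(euclidean.toMixed K).symm u, complexPlaceVectorRe K w⟫ = (u.2 w).re := by
  rw [complexPlaceVectorRe, real_inner_comm, ← OrthonormalBasis.repr_apply_apply,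
    stdOrthonormalBasis_repr_apply, ContinuousLinearEquiv.apply_symm_apply, stdBasis_apply_isComplex_fst]

/-- `⟪toMixed⁻¹ u, E_{w,i}⟫ = Im u_w`. [cite: NeukirchANT1999, Ch. VII §3 (3.4) (proof steps)] -/
theorem inner_toMixed_symm_complexPlaceVectorIm (u : mixedSpace K) (w : {w : InfinitePlace K // IsComplex w}) :
    ⟪(euclidean.toMixed K).symm u, complexPlaceVectorIm K w⟫ = (u.2 w).im := by
  rw [complexPlaceVectorIm, real_inner_comm, ← OrthonormalBasis.repr_apply_apply,
    stdOrthonormalBasis_repr_apply, ContinuousLinearEquiv.apply_symm_apply, stdBasis_apply_isComplex_snd]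

/-- The two unit vectors of a complex place are orthogonal. [cite: NeukirchANT1999, Ch. VII §3 (3.4) (proof steps)] -/
theorem inner_complexPlaceVectorRe_complexPlaceVectorIm (w : {w : InfinitePlace K // IsComplex w}) :
    ⟪complexPlaceVectorRe K w, complexPlaceVectorIm K w⟫ = 0 :=
  (euclidean.stdOrthonormalBasis K).orthonormal.inner_eq_zero (by simp)

/-- The two unit vectors of a complex place have the same length (`= 1`).
[cite: NeukirchANT1999, Ch. VII §3 (3.4) (proof steps)] -/
theorem norm_complexPlaceVectorRe_eq (w : {w : InfinitePlace K // IsComplex w}) :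
    ‖complexPlaceVectorRe K w‖ = ‖complexPlaceVectorIm K w‖ := by
  rw [complexPlaceVectorRe, complexPlaceVectorIm, (euclidean.stdOrthonormalBasis K).orthonormal.norm_eq_one,
    (euclidean.stdOrthonormalBasis K).orthonormal.norm_eq_one]

/-- **The complex coordinate**: `ℓ_w(toMixed⁻¹ u) = ⟨toMixed⁻¹ u, E_{w,1}⟩ + i⟨toMixed⁻¹ u, E_{w,i}⟩ = u_w`.
[cite: NeukirchANT1999, Ch. VII §3 (3.4) (proof steps)] -/
theorem cLin_toMixed_symm (u : mixedSpace K) (w : {w : InfinitePlace K // IsComplex w}) :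
    Fourier.cLin (complexPlaceVectorRe K w) (complexPlaceVectorIm K w) ((euclidean.toMixed K).symm u) = u.2 w := by
  rw [Fourier.cLin_apply, inner_toMixed_symm_complexPlaceVectorRe, inner_toMixed_symm_complexPlaceVectorIm]
  exact Complex.re_add_im _

/-- `ℓ_w` on a scaled lattice vector: `ℓ_w(toMixed⁻¹(c·j(a))) = c_w σ_w(a)`.
[cite: NeukirchANT1999, Ch. VII §3 (3.4) (proof steps)] -/
theorem cLin_scaleMixed_mixedEmbedding (w : {w : InfinitePlace K // IsComplex w}) (c : InfinitePlace K → ℝ) (a : K) :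
    Fourier.cLin (complexPlaceVectorRe K w) (complexPlaceVectorIm K w)
        ((euclidean.toMixed K).symm (scaleMixed K c (mixedEmbedding K a))) = (c w.1 : ℂ) * w.1.embedding a := by
  rw [cLin_toMixed_symm, scaleMixed_apply_snd, mixedEmbedding_apply_isComplex]

/-- `ℓ_w` on a scaled dual vector: `ℓ_w(toMixed⁻¹(c⁻¹·*j(a'))) = 2 c_w⁻¹ conj(σ_w(a'))` (`*` conjugates, and doubles, the
complex coordinates). [cite: NeukirchANT1999, Ch. VII (5.7) (proof steps)] -/
theorem cLin_scaleMixed_inv_twistMixed (w : {w : InfinitePlace K // IsComplex w}) (c : InfinitePlace K → ℝ) (a' : K) :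
    Fourier.cLin (complexPlaceVectorRe K w) (complexPlaceVectorIm K w)
        ((euclidean.toMixed K).symm (scaleMixed K c⁻¹ (twistMixed (mixedEmbedding K a')))) =
      ((c w.1)⁻¹ : ℂ) * (2 * conj (w.1.embedding a')) := by
  rw [cLin_toMixed_symm, scaleMixed_apply_snd, twistMixed_snd, mixedEmbedding_apply_isComplex, Pi.inv_apply,
    Complex.ofReal_inv]

/-! ## Hecke's theta functions with the harmonic weight `x_w^m` -/

variable (K)

/-- **Hecke's theta series of the coset `a₀ + 𝔞` with the harmonic weight `x_w^m` at the complex place `w`** at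
`z = iy`, `y ∈ R_+^*`: `Θ^{(m)}_{𝔞,a₀}(y) = Σ_{a ∈ 𝔞} σ_w(a + a₀)^m e^{-π⟨(a+a₀)y, a+a₀⟩}` (Neukirch VII (3.4) Definition,
`θ_Γ^p(a, b, z) = Σ_{g ∈ Γ} N((a+g)^p) e^{πi⟨(a+g)z, a+g⟩ + 2πi⟨b,g⟩}` for `Γ = j(𝔞)`, `a = a₀`, `b = 0`, `z = iy`, and the
admissible `p` with `p_w = m`, `p_w̄ = 0`, `p = 0` elsewhere), as a complex number.  For `m = 0`, `a₀ = 0` this is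
`θ_𝔞(iy) = thetaIdeal K 𝔞 y`; for an imaginary quadratic `K` and `𝔞, a₀` describing a ray class it is Hecke's theta
series of a Größencharakter of type `(m, 0)`. [cite: NeukirchANT1999, Ch. VII §3 (3.4) Definition] -/
def heckeThetaC (w : {w : InfinitePlace K // IsComplex w}) (m : ℕ) (I : FractionalIdeal (𝓞 K)⁰ K) (a₀ : K)
    (y : InfinitePlace K → ℝ) : ℂ :=
  ∑' a : I, w.1.embedding ((a : K) + a₀) ^ m * ((thetaSummand K y ((a : K) + a₀) : ℝ) : ℂ)

/-- **The dual theta series** `Θ̂^{(m)}_{𝔟,a₀}(y) = Σ_{b ∈ 𝔟} e^{2πi Tr(a₀ b)} conj(σ_w(b))^m e^{-π⟨by, b⟩}` (Neukirch's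
`θ_{Γ'}^p(-b, a, ·)` side of (3.6) for the twisted dual lattice `*Γ'`, with `b = 0`: character `e^{2πi⟨a₀, b⟩}`,
`⟨a₀, b⟩ = Tr(a₀ b)` for the trace form, no shift, and the CONJUGATE weight because `*` conjugates the complex
coordinates). [cite: NeukirchANT1999, Ch. VII §3 (3.4) Definition and (3.6)] -/
def heckeThetaDualC (w : {w : InfinitePlace K // IsComplex w}) (m : ℕ) (I : FractionalIdeal (𝓞 K)⁰ K) (a₀ : K)
    (y : InfinitePlace K → ℝ) : ℂ :=
  ∑' b : I, (𝐞 (((Algebra.trace ℚ K (a₀ * (b : K)) : ℚ) : ℝ)) : ℂ) *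
    (conj (w.1.embedding (b : K)) ^ m * ((thetaSummand K y (b : K) : ℝ) : ℂ))

variable {K}

/-! ## The transformation formula -/

omit [NumberField K] in
/-- At a complex place the scaling factor is `c_w = (2 t_w)^{1/2}` (`e_w = 2`): `c_w² = 2 t_w`.
[cite: NeukirchANT1999, Ch. VII §3 (3.6) (proof steps)] -/
theorem sqrt_mult_mul_sq_of_isComplex {t : InfinitePlace K → ℝ} (ht : ∀ v, 0 < t v)
    (w : {w : InfinitePlace K // IsComplex w}) : Real.sqrt (mult w.1 * t w.1) ^ 2 = 2 * t w.1 := by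
  rw [Real.sq_sqrt (mul_pos (Nat.cast_pos.mpr mult_pos) (ht w.1)).le, mult_isComplex w]
  norm_num

/-- **Theta transformation formula with a harmonic weight at a complex place and a shift** (Neukirch VII (3.6) Theta
Transformation Formula, `θ_Γ^p(a,b,-1/z) = [i^{Tr(p)} e^{2πi⟨a,b⟩} vol(Γ)]⁻¹ N((z/i)^{p+1/2}) θ_{Γ'}^p(-b,a,z)`, for
`Γ = j(𝔞)`, `Γ' = *j((𝔞𝔡)⁻¹)` (VII (5.7)), `b = 0`, and the admissible exponent `p_w = m` at ONE complex place; Hecke 1920):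
for a nonzero fractional ideal `𝔞`, `a₀ ∈ K`, a complex place `w`, `m : ℕ` and `t ∈ R_+^*`,
`Θ^{(m)}_{𝔞,a₀}(t) = (-i)^m (t_w^m N(t)^{1/2} 𝔑(𝔞) √|d_K|)⁻¹ Θ̂^{(m)}_{(𝔞𝔡)⁻¹,a₀}(t⁻¹)`.
[cite: NeukirchANT1999, Ch. VII §3 (3.6) Theta Transformation Formula, with (5.7)] -/
theorem heckeThetaC_eq_heckeThetaDualC (w : {w : InfinitePlace K // IsComplex w}) (m : ℕ)
    (I : (FractionalIdeal (𝓞 K)⁰ K)ˣ) (a₀ : K) {t : InfinitePlace K → ℝ} (ht : ∀ v, 0 < t v) :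
    heckeThetaC K w m I a₀ t =
      (-Complex.I) ^ m * ((((t w.1) ^ m * (Real.sqrt (mixedNorm K t) *
        ((FractionalIdeal.absNorm (I : FractionalIdeal (𝓞 K)⁰ K) : ℝ) * Real.sqrt |(discr K : ℝ)|))) : ℝ) : ℂ)⁻¹ *
      heckeThetaDualC K w m (FractionalIdeal.dual ℤ ℚ (I : FractionalIdeal (𝓞 K)⁰ K)) a₀ (fun v ↦ (t v)⁻¹) := by
  set c : InfinitePlace K → ℝ := fun v ↦ Real.sqrt (mult v * t v) with hcdef
  have hc : ∀ v, c v ≠ 0 := sqrt_mult_mul_ne_zero ht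
  set Λ := scaledIdealLattice c hc I with hΛ
  set x₀ : euclidean.mixedSpace K := (euclidean.toMixed K).symm (scaleMixed K c (mixedEmbedding K a₀))
    with hx₀
  set e₁ := complexPlaceVectorRe K w with he₁
  set e₂ := complexPlaceVectorIm K w with he₂
  have h12 : ⟪e₁, e₂⟫ = 0 := inner_complexPlaceVectorRe_complexPlaceVectorIm w
  have hnorm : ‖e₁‖ = ‖e₂‖ := norm_complexPlaceVectorRe_eq w
  set F : euclidean.mixedSpace K → ℂ := fun v ↦ Fourier.cpowGaussian e₁ e₂ m (v + x₀) with hF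
  -- hypotheses of Poisson summation
  set b : ℝ := Module.finrank ℝ (euclidean.mixedSpace K) + 1 with hbdef
  have hb : (Module.finrank ℝ (euclidean.mixedSpace K) : ℝ) < b := by rw [hbdef]; linarith
  have hb0 : 0 ≤ b := by rw [hbdef]; positivity
  obtain ⟨C, hC⟩ := Fourier.norm_cpowGaussian_add_le e₁ e₂ m x₀ hb0
  have hFour := Fourier.fourier_cpowGaussian_add h12 hnorm m x₀
  obtain ⟨C', hC'⟩ := Fourier.norm_cpowGaussian_add_le e₁ e₂ m (0 : euclidean.mixedSpace K) hb0
  have hdec' : ∀ v : euclidean.mixedSpace K, ‖𝓕 F v‖ ≤ C' * (1 + ‖v‖) ^ (-b) := by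
    intro v
    rw [hF, hFour]
    dsimp only
    rw [norm_mul, Circle.norm_coe, one_mul, norm_mul, norm_pow, norm_neg, Complex.norm_I, one_pow,
      one_mul]
    simpa using hC' v
  have hsum : Summable fun g' : Literature.Algebra.EuclideanLattices.dualLattice Λ ↦ 𝓕 F g' :=
    Fourier.summable_of_decay_zlattice _ hb hdec'
  have key := Fourier.tsum_eq_tsum_fourier_of_rpow_decay Λ
    (Fourier.continuous_cpowGaussian_add e₁ e₂ m x₀) hb hC hsum
  -- the lattice side
  have hL : ∑' g : Λ, F g = ((c w.1 : ℂ)) ^ m * heckeThetaC K w m I a₀ t := by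
    rw [← (idealEquivScaledIdealLattice c hc I).tsum_eq, heckeThetaC, ← tsum_mul_left]
    refine tsum_congr fun a ↦ ?_
    rw [coe_idealEquivScaledIdealLattice_apply, hF]
    dsimp only
    rw [hx₀, ← map_add, ← map_add, ← map_add, Fourier.cpowGaussian_apply, he₁, he₂,
      cLin_scaleMixed_mixedEmbedding, hcdef, norm_sq_scaleMixed_mixedEmbedding (fun v ↦ (ht v).le), thetaSummand]
    ring
  -- the dual side
  have hR : ∑' g' : Literature.Algebra.EuclideanLattices.dualLattice Λ, 𝓕 F g' =
      (-Complex.I) ^ m * (((c w.1 : ℂ))⁻¹ * 2) ^ m *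
        heckeThetaDualC K w m (FractionalIdeal.dual ℤ ℚ (I : FractionalIdeal (𝓞 K)⁰ K)) a₀ (fun v ↦ (t v)⁻¹) := by
    rw [← (dualIdealEquivDualLattice c hc I).tsum_eq, heckeThetaDualC, ← tsum_mul_left]
    refine tsum_congr fun a' ↦ ?_
    rw [coe_dualIdealEquivDualLattice_apply, hFour]
    dsimp only
    rw [hx₀, real_inner_comm, inner_dualVector_latticeVector hc, Fourier.cpowGaussian_apply, he₁, he₂,
      cLin_scaleMixed_inv_twistMixed, hcdef, norm_sq_scaleMixed_inv_twistMixed ht, thetaSummand,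
      mul_comm (a' : K) a₀]
    ring
  rw [hL, hR, covolume_scaledIdealLattice_sqrt ht hc I, Complex.real_smul] at key
  -- solve for `heckeThetaC`
  have hcw : (c w.1 : ℂ) ≠ 0 := by exact_mod_cast hc w.1
  have hcw2 : (c w.1 : ℂ) ^ 2 = 2 * (t w.1 : ℂ) := by
    have := sqrt_mult_mul_sq_of_isComplex ht w
    rw [hcdef]
    exact_mod_cast this
  have hP : ((c w.1 : ℂ)) ^ m ≠ 0 := pow_ne_zero _ hcw
  have hΘ : heckeThetaC K w m I a₀ t =
      (((c w.1 : ℂ)) ^ m)⁻¹ *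
        ((((Real.sqrt (mixedNorm K t) *
            ((FractionalIdeal.absNorm (I : FractionalIdeal (𝓞 K)⁰ K) : ℝ) * Real.sqrt |(discr K : ℝ)|))⁻¹ : ℝ) :
              ℂ) *
          ((-Complex.I) ^ m * (((c w.1 : ℂ))⁻¹ * 2) ^ m *
            heckeThetaDualC K w m (FractionalIdeal.dual ℤ ℚ (I : FractionalIdeal (𝓞 K)⁰ K)) a₀
              (fun v ↦ (t v)⁻¹))) := by
    rw [← key, ← mul_assoc, inv_mul_cancel₀ hP, one_mul]
  rw [hΘ]
  -- `(c_w^m)⁻¹ (2 c_w⁻¹)^m = (2 / c_w²)^m = t_w^{-m}`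
  have htw : (t w.1 : ℂ) ≠ 0 := by exact_mod_cast (ht w.1).ne'
  have hpow : (((c w.1 : ℂ)) ^ m)⁻¹ * (((c w.1 : ℂ))⁻¹ * 2) ^ m = ((t w.1 : ℂ) ^ m)⁻¹ := by
    rw [← inv_pow, ← mul_pow, ← inv_pow]
    congr 1
    calc ((c w.1 : ℂ))⁻¹ * (((c w.1 : ℂ))⁻¹ * 2) = 2 * (((c w.1 : ℂ)) ^ 2)⁻¹ := by ring
      _ = 2 * (2 * (t w.1 : ℂ))⁻¹ := by rw [hcw2]
      _ = (t w.1 : ℂ)⁻¹ := by rw [mul_inv, ← mul_assoc, mul_inv_cancel₀ two_ne_zero, one_mul]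
  set N : ℝ := Real.sqrt (mixedNorm K t) with hN
  set D : ℝ := (FractionalIdeal.absNorm (I : FractionalIdeal (𝓞 K)⁰ K) : ℝ) with hD
  set S : ℝ := Real.sqrt |(discr K : ℝ)| with hS
  set Θ : ℂ := heckeThetaDualC K w m (FractionalIdeal.dual ℤ ℚ (I : FractionalIdeal (𝓞 K)⁰ K)) a₀ (fun v ↦ (t v)⁻¹)
    with hΘdef
  push_cast
  linear_combination (-Complex.I) ^ m * ((N : ℂ) * ((D : ℂ) * (S : ℂ)))⁻¹ * Θ * hpow

end NumberField

end Literature.NumberTheory.LFunctions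

end
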